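import Summits.QuantumFields.YangMills.Theorems.ForcedResponseSkewnessFemtoEngineUnitTransfer
import Summits.QuantumFields.YangMills.Theorems.ForcedResponseSkewnessRunningCouplingCeilingLogCeilingOfFemto
import Summits.QuantumFields.YangMills.Theorems.ForcedResponseSkewnessRunningCouplingCeilingFemtoLogOfCentred
import Summits.QuantumFields.YangMills.Theorems.BalabanLadderNTBoundaryLawOscillation
import Summits.QuantumFields.YangMills.Theorems.LangevinControlUVOSLegsAtWeakCouplingCFblOfFbl6
import Summits.QuantumFields.YangMills.Theorems.BalabanLadderNTReferenceMargins
import Summits.QuantumFields.YangMills.Theorems.ForcedResponseSkewnessResponseLocalisationContactOfFemtoToolkit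
import HarnessLib

/-!
# Route `ForcedResponseSkewness`: the COARSE half of the unit pinning follows from the engine laws (lead `ym-line-frs-p1` g7, 2026-08-28)

Helper file (`--supports stmt-QuantumFields-26871`, also serves 24275), sequel of `…FemtoEngineUnitTransfer.lean`.

The route's registered physics debt `FemtoEngineSigR` (three femto laws in EVERY floor-pinned unit) equals «three laws in ONE
unit `u`» ∧ «clause-(i) floors pin the unit two-sidedly to `u`» (`femtoEngineSigR_of_ref`).  Here the COARSE half of the pinning
— no compactly supported positive-time witness keeps a floor `ε ≤ Q2` along couplings where the unit drifts coarser than `u`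
(`a β > M·u β`) — is DERIVED from the engine laws in the unit `u`:

* `logCeiling_of_femtoEngineAt` — `FemtoEngineAt G r u` ⇒ the torus running-coupling ceiling in the unit `u`
  (`d⁸|torusCov| ≤ C₀/log²(1/(u d))` for `n₀ ≤ d`, `u·d ≤ ½`, tori `u·L ≥ Λ₀`), by the landed chain
  `fbl6_of_oscillation` → `fbl_of_fbl6` → `localScaleFree_of_fbl` / `femtoLog_of_centred` → `logCeiling_of_femto`;
* `floorPins_coarse_of_logCeiling` — the torus log ceiling in the unit `u` and a floor at the unit `a` give `M` with
  `a β ≤ M·u β` eventually: at a coupling with `a β > M u β` every contributing pair of `Q2_{(β,L,aβ)}(θv₀, v₀)` sits at torus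
  distance `d ∈ [2δ/aβ, 2σ/aβ]` (`δ` the time gap, `σ` the support radius of `v₀`), i.e. at `u`-separation `≤ 2σ/M ≤ ½`, where
  the ceiling and the lattice `L¹` envelopes (`exists_sum_abs_schwartz_lattice_le_div_min`) give
  `Q2 ≤ K_θ K_v C₀⁺/((2δ)⁸ log²(M/(2σ))) < ε` — contradicting the floor on a large torus;
* `floorPins_coarse_of_femtoEngineAt` — the two combined; `floorPinsUnit_of_fine` — `FemtoEngineAt ∧ FloorPinsFine ⇒ FloorPinsUnit`;
* **`femtoEngineSigR_of_fine : FemtoEngineFineSigR → FemtoEngineSigR`** — the route's declared debt is «engine output in the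
  engine's unit» ∧ «FINE pinning» (no floor survives in a unit drifting FINER than `u`: hyperscaling-weighted decay of the density
  two-point function beyond the femto range — the one interface fact that is not an engine output).

HONEST LABEL: bookkeeping/analysis on a conditional rung line (leaf R2a `BalabanLadder.NT`); none of E0′/E-sym/E-log, `FloorPinsFine`,
the cruxes 26871/24275, the residual, NT or the Yang–Mills mass gap is proved.
-/

set_option autoImplicit false

noncomputable section

namespace Summit.QuantumFields.YangMills.Cruxes.ResponseLocalisation.FemtoEngine

open scoped SchwartzMap
open MeasureTheory Filter Topology Set Metric
open Literature.MathematicalPhysics.QuantumFieldTheory Literature.MathematicalPhysics.QuantumLattice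
open Literature.Probability.LatticeModels
open Summit.QuantumFields.YangMills.Cruxes.OSLegsFromFemtoAndGap.DlrCollarTransfer
open Summit.QuantumFields.YangMills.Cruxes.ResponseLocalisation.Birth
open Summit.QuantumFields.YangMills.Cruxes.RunningCouplingCeiling.Pointwise
open Summit.QuantumFields.YangMills.Cruxes.RunningCouplingCeiling.CentredLog (femtoLog_of_centred)
open Summit.QuantumFields.YangMills.Cruxes.NT.BoundaryLaw (fbl6_of_oscillation)
open Summit.QuantumFields.YangMills.Cruxes.NT.Reference (exists_timeGap_of_tsupport_subset)
open Summit.QuantumFields.YangMills.Cruxes.IR.AfOnset (exists_sum_abs_schwartz_lattice_le_div_min)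
open Summit.QuantumFields.YangMills.Cruxes.ResponseLocalisation.Femto (abs_apply_le_norm)

variable {G : Type} [Group G] [TopologicalSpace G] [IsTopologicalGroup G] [CompactSpace G]
  [MeasurableSpace G] [BorelSpace G] (r : LatticeRep G)

/-! ## §1 The torus log ceiling in the engine's unit -/

/-- **The engine laws in the unit `u` give the torus running-coupling ceiling in the unit `u`** (landed chain). [folklore] -/
theorem logCeiling_of_femtoEngineAt {u : ℝ → ℝ} (hu : ∀ β, 0 < u β) (hu0 : Tendsto u atTop (𝓝 0))
    (hE : FemtoEngineAt G r u) :
    ∃ C₀ : ℝ, ∃ n₀ : ℕ, ∃ β₀ Λ₀ : ℝ, ∀ β : ℝ, β₀ ≤ β → ∀ L : ℕ, Λ₀ ≤ u β * L →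
      ∀ x ∈ box 4 L, ∀ y ∈ box 4 L,
        (n₀ : ℝ) ≤ torusDist L x y → u β * torusDist L x y ≤ 1 / 2 →
          torusDist L x y ^ 8 * |torusCov G r β L x y| ≤ C₀ / Real.log (1 / (u β * torusDist L x y)) ^ 2 := by
  obtain ⟨hOsc, -, hLog⟩ := hE
  obtain ⟨D, C₁, β₁, ℓ₁, hℓ₁, H⟩ := hOsc
  have hF6 : FBL6 G r u := fbl6_of_oscillation G r u hu D ⟨C₁, β₁, ℓ₁, hℓ₁, H⟩
  have hF : FBL G r u := fbl_of_fbl6 r u hF6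
  have hSF := localScaleFree_of_fbl r hu hu0 hF (1 / 2) (by norm_num)
  have hFL := femtoLog_of_centred G r u hu hu0 hF hLog
  exact logCeiling_of_femto r hu hu0 hSF hF hFL

/-! ## §2 No floor survives in a unit drifting coarser than the log-ceiling unit -/

/-- A point of the scaled lattice where `v` does not vanish lies in the support ball: `‖t·x‖ ≤ σ`. [folklore] -/
theorem norm_smul_le_of_ne_zero {v : 𝓢(EuclideanSpace ℝ (Fin 4), ℝ)} {σ : ℝ}
    (hvσ : tsupport (v : EuclideanSpace ℝ (Fin 4) → ℝ) ⊆ closedBall 0 σ) {z : EuclideanSpace ℝ (Fin 4)}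
    (hz : v z ≠ 0) : ‖z‖ ≤ σ := by
  have h1 : z ∈ tsupport (v : EuclideanSpace ℝ (Fin 4) → ℝ) := subset_tsupport _ (Function.mem_support.2 hz)
  simpa using hvσ h1

/-- Algebra of the final constant. [folklore] -/
theorem envelope_algebra (K₁ K₂ C a δ Λ : ℝ) (ha : 0 < a) (hδ : 0 < δ) (hΛ : 0 < Λ) :
    K₁ / a ^ 4 * (K₂ / a ^ 4) * (C / ((2 * δ / a) ^ 8 * Λ ^ 2)) = K₁ * K₂ * C / (2 * δ) ^ 8 / Λ ^ 2 := by
  have h8 : (2 * δ / a) ^ 8 = (2 * δ) ^ 8 / a ^ 8 := by rw [div_pow]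
  rw [h8]
  field_simp

/-- **No floor in a unit drifting coarser than the log-ceiling unit.**  The torus running-coupling ceiling in the unit `u` and
a compactly supported positive-time floor witness in the unit `a` give `M` with `a β ≤ M·u β` eventually. [folklore] -/
theorem floorPins_coarse_of_logCeiling {u : ℝ → ℝ} (hu : ∀ β, 0 < u β)
    (hLC : ∃ C₀ : ℝ, ∃ n₀ : ℕ, ∃ β₀ Λ₀ : ℝ, ∀ β : ℝ, β₀ ≤ β → ∀ L : ℕ, Λ₀ ≤ u β * L →
      ∀ x ∈ box 4 L, ∀ y ∈ box 4 L,
        (n₀ : ℝ) ≤ torusDist L x y → u β * torusDist L x y ≤ 1 / 2 →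
          torusDist L x y ^ 8 * |torusCov G r β L x y| ≤ C₀ / Real.log (1 / (u β * torusDist L x y)) ^ 2)
    {a : ℝ → ℝ} (ha : ∀ β, 0 < a β) (ha0 : Tendsto a atTop (𝓝 0))
    (hfloor : ∃ (v₀ : 𝓢(EuclideanSpace ℝ (Fin 4), ℝ)) (ε β₅ Λ₅ : ℝ),
      HasCompactSupport (v₀ : EuclideanSpace ℝ (Fin 4) → ℝ) ∧
      tsupport (v₀ : EuclideanSpace ℝ (Fin 4) → ℝ) ⊆ {y : EuclideanSpace ℝ (Fin 4) | 0 < y 0} ∧ 0 < ε ∧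
      ∀ β : ℝ, β₅ ≤ β → ∀ L : ℕ, Λ₅ ≤ a β * L → ε ≤ Q2 G r β L (a β) (thetaTest 4 v₀) v₀) :
    ∃ M : ℝ, 0 < M ∧ ∀ᶠ β in atTop, a β ≤ M * u β := by
  obtain ⟨C₀, n₀, β₀, Λ₀, HLC⟩ := hLC
  obtain ⟨v₀, ε, β₅, Λ₅, hK, hpos, hε, hfl⟩ := hfloor
  -- support radius and time gap of the witness
  obtain ⟨σ₀, hvσ₀⟩ := hK.isCompact.isBounded.subset_closedBall (0 : EuclideanSpace ℝ (Fin 4))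
  obtain ⟨σ, hσ, hvσ⟩ : ∃ σ : ℝ, 0 < σ ∧ tsupport (v₀ : EuclideanSpace ℝ (Fin 4) → ℝ) ⊆ closedBall 0 σ :=
    ⟨max σ₀ 1, lt_of_lt_of_le one_pos (le_max_right _ _), hvσ₀.trans (closedBall_subset_closedBall (le_max_left _ _))⟩
  obtain ⟨δ, hδ, hvδ⟩ := exists_timeGap_of_tsupport_subset hpos hvσ
  -- lattice L¹ envelopes
  obtain ⟨Kv, hKv0, hKv⟩ := exists_sum_abs_schwartz_lattice_le_div_min v₀
  obtain ⟨Kθ, hKθ0, hKθ⟩ := exists_sum_abs_schwartz_lattice_le_div_min (thetaTest 4 v₀)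
  -- the constants: `Q2 ≤ A / log²(l/(2σ))` along a drift `a = l·u`, and `A/T² < ε`, `M = 2σe^T + 4σ`
  obtain ⟨A, hA0, hA⟩ : ∃ A : ℝ, 0 ≤ A ∧ A = Kθ * Kv * max C₀ 0 / (2 * δ) ^ 8 :=
    ⟨_, by positivity, rfl⟩
  obtain ⟨T, hT0, hAT⟩ : ∃ T : ℝ, 0 < T ∧ A / T ^ 2 < ε := by
    refine ⟨Real.sqrt (A / ε) + 1, by positivity, ?_⟩
    rw [div_lt_iff₀ (by positivity)]
    have h1 : Real.sqrt (A / ε) ^ 2 = A / ε := Real.sq_sqrt (div_nonneg hA0 hε.le)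
    have h2 : A = ε * Real.sqrt (A / ε) ^ 2 := by rw [h1]; field_simp
    have h3 : Real.sqrt (A / ε) ^ 2 < (Real.sqrt (A / ε) + 1) ^ 2 := by nlinarith [Real.sqrt_nonneg (A / ε)]
    calc A = ε * Real.sqrt (A / ε) ^ 2 := h2
      _ < ε * (Real.sqrt (A / ε) + 1) ^ 2 := mul_lt_mul_of_pos_left h3 hε
  set M : ℝ := 2 * σ * Real.exp T + 4 * σ with hM
  have hexp : 0 < Real.exp T := Real.exp_pos T
  have hM0 : 0 < M := by positivity
  have hM4 : 4 * σ ≤ M := by nlinarith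
  have hMexp : 2 * σ * Real.exp T ≤ M := by nlinarith
  refine ⟨M, hM0, ?_⟩
  -- thresholds in β
  have hsmall : ∀ᶠ β in atTop, a β ≤ min 1 (2 * δ / ((n₀ : ℝ) + 1)) := by
    have h1 : (0 : ℝ) < min 1 (2 * δ / ((n₀ : ℝ) + 1)) := lt_min one_pos (by positivity)
    exact (ha0.eventually (Iic_mem_nhds h1)).mono fun β h => h
  filter_upwards [hsmall, eventually_ge_atTop β₅, eventually_ge_atTop β₀] with β hβs hβ₅ hβ₀
  have haβ := ha β
  have huβ := hu β
  have ha1 : a β ≤ 1 := hβs.trans (min_le_left _ _)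
  have han : (n₀ : ℝ) * a β ≤ 2 * δ := by
    have h1 : a β ≤ 2 * δ / ((n₀ : ℝ) + 1) := hβs.trans (min_le_right _ _)
    rw [le_div_iff₀ (by positivity)] at h1
    nlinarith [Nat.cast_nonneg (α := ℝ) n₀]
  by_contra hlt
  have hlt' : M * u β < a β := lt_of_not_ge hlt
  -- the drift ratio
  obtain ⟨l, hl0, hMl, hal⟩ : ∃ l : ℝ, 0 < l ∧ M < l ∧ a β = l * u β := by
    refine ⟨a β / u β, div_pos haβ huβ, ?_, ?_⟩
    · rw [lt_div_iff₀ huβ]; exact hlt'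
    · field_simp
  -- a large torus
  obtain ⟨L, hL5, hL0, hLσ⟩ : ∃ L : ℕ, Λ₅ ≤ a β * L ∧ Λ₀ ≤ u β * L ∧ 2 * σ / a β ≤ L := by
    refine ⟨⌈max (max (Λ₅ / a β) (Λ₀ / u β)) (2 * σ / a β)⌉₊, ?_, ?_, ?_⟩
    · have h1 : Λ₅ / a β ≤ ⌈max (max (Λ₅ / a β) (Λ₀ / u β)) (2 * σ / a β)⌉₊ :=
        ((le_max_left _ _).trans (le_max_left _ _)).trans (Nat.le_ceil _)
      rw [div_le_iff₀ haβ] at h1; linarith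
    · have h1 : Λ₀ / u β ≤ ⌈max (max (Λ₅ / a β) (Λ₀ / u β)) (2 * σ / a β)⌉₊ :=
        ((le_max_right _ _).trans (le_max_left _ _)).trans (Nat.le_ceil _)
      rw [div_le_iff₀ huβ] at h1; linarith
    · exact (le_max_right _ _).trans (Nat.le_ceil _)
  -- the floor on this torus
  have hfloorβ := hfl β hβ₅ L hL5
  rw [Q2_eq_sum_torusCov] at hfloorβ
  -- the pair bound `|torusCov x y| ≤ P` on contributing pairs
  have hlog : T ≤ Real.log (l / (2 * σ)) := by
    have h1 : Real.exp T ≤ l / (2 * σ) := by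
      rw [le_div_iff₀ (by positivity)]; linarith
    calc T = Real.log (Real.exp T) := (Real.log_exp T).symm
      _ ≤ Real.log (l / (2 * σ)) := Real.log_le_log hexp h1
  have hlog0 : 0 < Real.log (l / (2 * σ)) := hT0.trans_le hlog
  set P : ℝ := max C₀ 0 / ((2 * δ / a β) ^ 8 * Real.log (l / (2 * σ)) ^ 2) with hP
  have hP0 : 0 ≤ P := by positivity
  have pair : ∀ x ∈ box 4 L, ∀ y ∈ box 4 L,
      |thetaTest 4 v₀ (a β • siteToE x)| * |v₀ (a β • siteToE y)| * |torusCov G r β L x y| ≤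
        |thetaTest 4 v₀ (a β • siteToE x)| * |v₀ (a β • siteToE y)| * P := by
    intro x hx y hy
    by_cases hx0 : thetaTest 4 v₀ (a β • siteToE x) = 0
    · simp [hx0]
    by_cases hy0 : v₀ (a β • siteToE y) = 0
    · simp [hy0]
    apply mul_le_mul_of_nonneg_left _ (by positivity)
    have hx0' : v₀ (timeReflection 4 (a β • siteToE x)) ≠ 0 := by rwa [thetaTest_apply] at hx0
    -- geometry of the contributing pair
    have hyt : δ ≤ a β * (y 0 : ℝ) := by
      have h := hvδ _ hy0
      rwa [Summit.QuantumFields.YangMills.Cruxes.NT.Reference.smul_siteToE_apply_zero] at h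
    have hxt : a β * (x 0 : ℝ) ≤ -δ := by
      have h := hvδ _ hx0'
      rw [timeReflection_apply, if_pos rfl,
        Summit.QuantumFields.YangMills.Cruxes.NT.Reference.smul_siteToE_apply_zero] at h
      linarith
    have hny : a β * ‖siteToE y‖ ≤ σ := by
      have h1 := norm_smul_le_of_ne_zero hvσ hy0
      rwa [norm_smul, Real.norm_of_nonneg haβ.le] at h1
    have hnx : a β * ‖siteToE x‖ ≤ σ := by
      have h1 := norm_smul_le_of_ne_zero hvσ hx0'
      rwa [LinearIsometryEquiv.norm_map, norm_smul, Real.norm_of_nonneg haβ.le] at h1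
    have hyσ : a β * |((y 0 : ℤ) : ℝ)| ≤ σ :=
      le_trans (mul_le_mul_of_nonneg_left (abs_apply_le_norm y 0) haβ.le) hny
    have hxσ : a β * |((x 0 : ℤ) : ℝ)| ≤ σ :=
      le_trans (mul_le_mul_of_nonneg_left (abs_apply_le_norm x 0) haβ.le) hnx
    -- torus distance of the pair: between `2δ/aβ` and `2σ/aβ`
    have hgap : 2 * δ ≤ a β * (((y 0 : ℤ) : ℝ) - ((x 0 : ℤ) : ℝ)) := by
      have : a β * (((y 0 : ℤ) : ℝ) - ((x 0 : ℤ) : ℝ)) = a β * (y 0 : ℝ) - a β * (x 0 : ℝ) := by ring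
      rw [this]; linarith
    have hdiff_pos : 0 < ((y 0 : ℤ) : ℝ) - ((x 0 : ℤ) : ℝ) := by
      by_contra hneg
      have : a β * (((y 0 : ℤ) : ℝ) - ((x 0 : ℤ) : ℝ)) ≤ 0 :=
        mul_nonpos_of_nonneg_of_nonpos haβ.le (not_lt.mp hneg)
      linarith
    have habs : (|x 0 - y 0| : ℝ) = ((y 0 : ℤ) : ℝ) - ((x 0 : ℤ) : ℝ) := by
      rw [abs_sub_comm, abs_of_pos hdiff_pos]
    have hdlow : 2 * δ / a β ≤ torusDist L x y := by
      have h1 : 2 * δ / a β ≤ (|x 0 - y 0| : ℝ) := by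
        rw [habs, div_le_iff₀ haβ]; linarith [hgap]
      have h3 : |x 0 - y 0| ≤ (L : ℤ) := by
        have h4 : (|x 0 - y 0| : ℝ) ≤ L := by
          rw [habs]
          have h5 : ((y 0 : ℤ) : ℝ) ≤ |((y 0 : ℤ) : ℝ)| := le_abs_self _
          have h6 : -((x 0 : ℤ) : ℝ) ≤ |((x 0 : ℤ) : ℝ)| := neg_le_abs _
          have h7 : a β * (|((y 0 : ℤ) : ℝ)| + |((x 0 : ℤ) : ℝ)|) ≤ 2 * σ := by linarith
          have h8 : |((y 0 : ℤ) : ℝ)| + |((x 0 : ℤ) : ℝ)| ≤ 2 * σ / a β := by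
            rw [le_div_iff₀ haβ, mul_comm]; exact h7
          linarith
        exact_mod_cast h4
      exact h1.trans (abs_sub_le_torusDist L x y h3)
    have hd0 : 0 < torusDist L x y := lt_of_lt_of_le (by positivity) hdlow
    have hdup : torusDist L x y ≤ 2 * σ / a β := by
      calc torusDist L x y ≤ ‖siteToE x - siteToE y‖ := torusDist_le_norm_sub L x y
        _ ≤ ‖siteToE x‖ + ‖siteToE y‖ := norm_sub_le _ _
        _ ≤ 2 * σ / a β := by
            rw [le_div_iff₀ haβ]; nlinarith
    -- hypotheses of the log ceiling
    have hn₀ : (n₀ : ℝ) ≤ torusDist L x y := by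
      refine le_trans ?_ hdlow
      rw [le_div_iff₀ haβ]; exact han
    have hud : u β * torusDist L x y ≤ 2 * σ / l := by
      have h1 : u β * torusDist L x y ≤ u β * (2 * σ / a β) := mul_le_mul_of_nonneg_left hdup huβ.le
      have h2 : u β * (2 * σ / a β) = 2 * σ / l := by rw [hal]; field_simp
      linarith
    have h2σl : 2 * σ / l ≤ 1 / 2 := by
      rw [div_le_iff₀ hl0]; linarith
    have hud2 : u β * torusDist L x y ≤ 1 / 2 := hud.trans h2σl
    have hLCxy := HLC β hβ₀ L hL0 x hx y hy hn₀ hud2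
    -- the logarithms
    have hlogd : Real.log (l / (2 * σ)) ≤ Real.log (1 / (u β * torusDist L x y)) := by
      apply Real.log_le_log (by positivity)
      rw [le_div_iff₀ (mul_pos huβ hd0)]
      calc l / (2 * σ) * (u β * torusDist L x y) ≤ l / (2 * σ) * (2 * σ / l) :=
            mul_le_mul_of_nonneg_left hud (by positivity)
        _ = 1 := by field_simp
    have hlp : 0 < Real.log (1 / (u β * torusDist L x y)) := hlog0.trans_le hlogd
    have hC0 : |torusCov G r β L x y| ≤
        max C₀ 0 / (torusDist L x y ^ 8 * Real.log (1 / (u β * torusDist L x y)) ^ 2) := by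
      rw [le_div_iff₀ (by positivity)]
      calc |torusCov G r β L x y| * (torusDist L x y ^ 8 * Real.log (1 / (u β * torusDist L x y)) ^ 2)
          = torusDist L x y ^ 8 * |torusCov G r β L x y| * Real.log (1 / (u β * torusDist L x y)) ^ 2 := by ring
        _ ≤ C₀ / Real.log (1 / (u β * torusDist L x y)) ^ 2 * Real.log (1 / (u β * torusDist L x y)) ^ 2 :=
            mul_le_mul_of_nonneg_right hLCxy (by positivity)
        _ = C₀ := by field_simp
        _ ≤ max C₀ 0 := le_max_left _ _
    calc |torusCov G r β L x y|
        ≤ max C₀ 0 / (torusDist L x y ^ 8 * Real.log (1 / (u β * torusDist L x y)) ^ 2) := hC0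
      _ ≤ P := by
          apply div_le_div_of_nonneg_left (le_max_right _ _) (by positivity)
          apply mul_le_mul (pow_le_pow_left₀ (by positivity) hdlow 8) _ (by positivity) (by positivity)
          exact pow_le_pow_left₀ hlog0.le hlogd 2
  -- summing up
  have hsum : ∑ x ∈ box 4 L, ∑ y ∈ box 4 L,
      thetaTest 4 v₀ (a β • siteToE x) * v₀ (a β • siteToE y) * torusCov G r β L x y ≤ A / T ^ 2 := by
    calc ∑ x ∈ box 4 L, ∑ y ∈ box 4 L, thetaTest 4 v₀ (a β • siteToE x) * v₀ (a β • siteToE y) * torusCov G r β L x y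
        ≤ ∑ x ∈ box 4 L, ∑ y ∈ box 4 L,
            |thetaTest 4 v₀ (a β • siteToE x)| * |v₀ (a β • siteToE y)| * P := by
          refine Finset.sum_le_sum fun x hx => Finset.sum_le_sum fun y hy => ?_
          refine le_trans (le_abs_self _) ?_
          rw [abs_mul, abs_mul]
          exact pair x hx y hy
      _ = (∑ x ∈ box 4 L, |thetaTest 4 v₀ (a β • siteToE x)|) * (∑ y ∈ box 4 L, |v₀ (a β • siteToE y)|) * P := by
          rw [Finset.sum_mul_sum, Finset.sum_mul]
          simp_rw [Finset.sum_mul]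
      _ ≤ (Kθ / (min (a β) 1) ^ 4) * (Kv / (min (a β) 1) ^ 4) * P := by
          apply mul_le_mul_of_nonneg_right _ hP0
          exact mul_le_mul (hKθ _ haβ _) (hKv _ haβ _) (Finset.sum_nonneg fun _ _ => abs_nonneg _)
            (div_nonneg hKθ0 (by positivity))
      _ = A / Real.log (l / (2 * σ)) ^ 2 := by
          rw [min_eq_left ha1, hP, hA, envelope_algebra Kθ Kv (max C₀ 0) (a β) δ _ haβ hδ hlog0]
      _ ≤ A / T ^ 2 := by
          apply div_le_div_of_nonneg_left hA0 (by positivity)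
          exact pow_le_pow_left₀ hT0.le hlog 2
  linarith

/-- **The coarse half of the pinning from the engine laws**: `FemtoEngineAt G r u` ⇒ every floor-pinned unit `a` satisfies
`a ≤ M·u` eventually. [folklore] -/
theorem floorPins_coarse_of_femtoEngineAt {u : ℝ → ℝ} (hu : ∀ β, 0 < u β) (hu0 : Tendsto u atTop (𝓝 0))
    (hE : FemtoEngineAt G r u) {a : ℝ → ℝ} (ha : ∀ β, 0 < a β) (ha0 : Tendsto a atTop (𝓝 0))
    (hfloor : ∃ (v₀ : 𝓢(EuclideanSpace ℝ (Fin 4), ℝ)) (ε β₅ Λ₅ : ℝ),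
      HasCompactSupport (v₀ : EuclideanSpace ℝ (Fin 4) → ℝ) ∧
      tsupport (v₀ : EuclideanSpace ℝ (Fin 4) → ℝ) ⊆ {y : EuclideanSpace ℝ (Fin 4) | 0 < y 0} ∧ 0 < ε ∧
      ∀ β : ℝ, β₅ ≤ β → ∀ L : ℕ, Λ₅ ≤ a β * L → ε ≤ Q2 G r β L (a β) (thetaTest 4 v₀) v₀) :
    ∃ M : ℝ, 0 < M ∧ ∀ᶠ β in atTop, a β ≤ M * u β :=
  floorPins_coarse_of_logCeiling r hu (logCeiling_of_femtoEngineAt r hu hu0 hE) ha ha0 hfloor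

/-! ## §3 The fine side is the only extra -/

/-- **`FemtoEngineAt ∧ FloorPinsFine ⇒ FloorPinsUnit`** (two-sided pinning from fine pinning and the engine laws). [folklore] -/
theorem floorPinsUnit_of_fine {u : ℝ → ℝ} (hu : ∀ β, 0 < u β) (hu0 : Tendsto u atTop (𝓝 0))
    (hE : FemtoEngineAt G r u) (hF : FloorPinsFine G r u) : FloorPinsUnit G r u := by
  intro a ha ha0 hfloor
  obtain ⟨M, hM, hcoarse⟩ := floorPins_coarse_of_femtoEngineAt r hu hu0 hE ha ha0 hfloor
  obtain ⟨C, hfine⟩ := hF a ha ha0 hfloor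
  refine ⟨1 / M, C, by positivity, ?_⟩
  filter_upwards [hcoarse, hfine] with β h1 h2
  refine ⟨?_, h2⟩
  rw [one_div, inv_mul_le_iff₀ hM]
  exact h1

omit [MeasurableSpace G] [BorelSpace G] in
/-- **The interface in a reference unit with FINE pinning implies the registered interface**:
`FemtoEngineFineSigR → FemtoEngineSigR`.  The route's declared debt outside the residual is therefore «the three engine laws in
ONE unit per `(G, r)`» ∧ «no clause-(i) floor survives in a unit drifting finer than that unit».  Nothing of either is proved. [folklore] -/
theorem femtoEngineSigR_of_fine (hF : FemtoEngineFineSigR) : FemtoEngineSigR := by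
  apply femtoEngineSigR_of_ref
  intro G _ _ _ _ hG
  letI : MeasurableSpace G := borel G
  haveI : BorelSpace G := ⟨rfl⟩
  intro r
  obtain ⟨u, hu, hu0, hE, hP⟩ := hF G hG r
  exact ⟨u, hu, hu0, hE, floorPinsUnit_of_fine r hu hu0 hE hP⟩

end Summit.QuantumFields.YangMills.Cruxes.ResponseLocalisation.FemtoEngine

end
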